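import Summits.CriticalPhenomena.PercolationContinuityZ3.Theorems.PercNearOneGluingNoHeavyLowerTailSahiCombTriWBotEmptyHalfChain
import Summits.CriticalPhenomena.PercolationContinuityZ3.Theorems.PercNearOneGluingNoHeavyLowerTailSahiCombTriWComparableMiddles

/-!
# `TRI_W(2)`: the INDEPENDENT-MIDDLES normal form and the typed HALF-CHAIN target (HC)

Support file of the one-cut programme (crux `NoHeavyLowerTail`, stmt-CriticalPhenomena-4575; cell `prim-masterthm`, seat P5 gen 27;
memo `FROM-prim-masterthm-p5-g27-JOINT-LATTICE-CONE.md` §3).  Target of the lane: `FiveUpSet.TriWIneq` (`…SahiCombTriWGeneral`, OPEN for `a ≥ 2`).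

At `a = 2` (index square `univ = {a, b}`) every index term of `triW` contains exactly ONE fibre of `F` (`triWOne_split_left`, prim-lf-1 gen 37), so

* **`FiveUpSet.triW_two_eq_fourMid`** — `triW P F G = M(F ∅; G univ, G ∅) + M(F univ; G ∅, G univ) + M(F{a}; G{b}, G{a}) + M(F{b}; G{a}, G{b})` with the
  one-fibre functional `M(A; Y, Y') := triWOne(P; ∅, A; Y, Y')`: for fixed `P, G` and fixed outer fibres the two MIDDLE fibres `F{a}, F{b}` enter through two
  INDEPENDENT summands, each ranging over the interval `[F ∅, F univ]` — `TriWIneq(2)` is "outer pair + two independent min-closure problems ≥ 0".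
* `FiveUpSet.triWOne_mid_nonneg` — if `B ⊆ B'` then `0 ≤ M(A'; B, B')` for EVERY up-set `A'` (a nested five-up-set instance with empty bottom): on the
  half-chain stratum `G{a} ⊆ G{b}` the `{b}`-middle summand is never negative.
* **`FiveUpSet.HalfChainMidIneq`** (`@[conjecture]`, OURS — an obligation of the theory, never a fact) — the half-chain stratum in index-free form: for up-sets
  `P; F₀ ⊆ A, A' ⊆ F₁; G₀ ⊆ B ⊆ B' ⊆ G₁` of a finite cube, `0 ≤ M(F₀;G₁,G₀) + M(F₁;G₀,G₁) + M(A;B',B) + M(A';B,B')`.  By `…TriWComparableMiddles` the open part of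
  `a = 2` is "at least one family has incomparable middles"; (HC) is "exactly one".  KNOWN CASES, proved here in the 9-set language by transporting the tree's strata
  through the diamond family `dfam` (`triW_dfam`): `A, A'` comparable (`halfChainMid_of_comparable`: five-up-set / AN♯3 via `triW_nonneg_of_comparable_middles`),
  `F₀ = ∅` (`halfChainMid_of_bot_empty`: lf-1 gen 37), `A = F₀ ∨ A' = F₀` (`halfChainMid_of_bot_eq`: `triW_nonneg_of_bot_eq_atom`).  OPEN: `F₀ ≠ ∅` with `A, A'`
  incomparable.  EVIDENCE (memo §1, §3): it is NOT pointwise-certifiable — the antipodal-pair-type LP over every proved atom family with arguments in the FULL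
  lattice generated by the nine sets (joint Kleitman cone priced exactly over all 1,035,496 lattice up-sets) has fooling value 91/522; its component normal form
  `Σ_C |L(C)| ≤ T_out + κ(U₀) + ½κ(U₁∖U₀)` over the connected components `C` of `(A∪A')∖(A∩A')` is exhaustively tight at `n = 3` with the budget shared by
  ≥ 2 components (the proved comparable cases give `|Σ_C L(C)| ≤ …`, off by a factor 2 on the shared part).  TRUE on every cell with `n ≤ 5` (tree certificates).
* **`FiveUpSet.triW_nonneg_two_of_halfChainMid`** — `HalfChainMidIneq →` (`univ = {a,b}`, `G{a} ⊆ G{b}`) `→ 0 ≤ triW P F G` (and the mirror `G{b} ⊆ G{a}`).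
HONEST LABEL: an identity, a typed conjecture with its reduction to the crux target, and re-packagings of proved strata; NO new stratum is proved. [this work]
-/

namespace Summit.CriticalPhenomena.PercolationContinuityZ3.Theorems

namespace FiveUpSet

open Finset LatticeFiveUpSet

variable {γ : Type} [DecidableEq γ] [Fintype γ]

/-! ### The independent-middles identity -/

/-- **Independent middles at `a = 2`.**  For an index square `univ = {a, b}` (no hypothesis on `P, F, G`):
`triW P F G = triWOne(P;∅,F ∅;G univ,G ∅) + triWOne(P;∅,F univ;G ∅,G univ) + triWOne(P;∅,F{a};G{b},G{a}) + triWOne(P;∅,F{b};G{a},G{b})` —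
each fibre of `F` sits in its own summand (`triW_eq_pairSum` + `triWOne_split_left` twice). [this work] -/
theorem triW_two_eq_fourMid {β : Type} [DecidableEq β] [Fintype β] {a b : β} (hab : a ≠ b) (hu : (univ : Finset β) = {a, b})
    (P : Finset (Finset γ)) (F G : Finset β → Finset (Finset γ)) :
    triW P F G = triWOne (complEquiv γ) P ∅ (F ∅) (G univ) (G ∅) + triWOne (complEquiv γ) P ∅ (F univ) (G ∅) (G univ)
      + triWOne (complEquiv γ) P ∅ (F {a}) (G {b}) (G {a}) + triWOne (complEquiv γ) P ∅ (F {b}) (G {a}) (G {b}) := by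
  rw [triW_eq_pairSum hab hu P F G, triWOne_split_left P (F ∅) (F univ) (G ∅) (G univ),
    triWOne_split_left P (F {a}) (F {b}) (G {a}) (G {b})]
  ring

/-- On a nested pair `B ⊆ B'` the one-fibre functional with empty bottom is a nested thin-edge functional, hence non-negative for EVERY up-set `A'`:
`0 ≤ triWOne(P;∅,A';B,B')` (five-up-set theorem, `triWOne_nonneg_cube`).  On the half-chain stratum this is the `{b}`-middle summand of
`triW_two_eq_fourMid`. [this work] -/
theorem triWOne_mid_nonneg (P A' B B' : Finset (Finset γ)) (hP : IsUpperSet (P : Set (Finset γ))) (hA' : IsUpperSet (A' : Set (Finset γ)))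
    (hB : IsUpperSet (B : Set (Finset γ))) (hB' : IsUpperSet (B' : Set (Finset γ))) (hBB' : B ⊆ B') :
    0 ≤ triWOne (complEquiv γ) P ∅ A' B B' := by
  have h := triWOne_nonneg_cube γ P ∅ A' B B' hP isUpperSet_empty hA' hB hB' (empty_subset _) hBB'
  have e : (⟨compl, compl, compl_compl, compl_compl⟩ : Finset γ ≃ Finset γ) = complEquiv γ := rfl
  rwa [e] at h

/-! ### The typed half-chain target -/

/-- **(HC) — the half-chain stratum of `TRI_W(2) ≥ 0`, index-free** (CONJECTURE — an obligation of our theory, never a fact; memo g27 §3).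
For up-sets `P`, `F₀ ⊆ A ⊆ F₁`, `F₀ ⊆ A' ⊆ F₁` (a diamond of `F`-fibres) and a CHAIN `G₀ ⊆ B ⊆ B' ⊆ G₁` of a finite cube:
`0 ≤ triWOne(P;∅,F₀;G₁,G₀) + triWOne(P;∅,F₁;G₀,G₁) + triWOne(P;∅,A;B',B) + triWOne(P;∅,A';B,B')`.
Equivalent to `TriWIneq` at `a = 2` restricted to `G{a} ⊆ G{b}` (`triW_nonneg_two_of_halfChainMid`, `triW_dfam`).  Known: `A, A'` comparable, `F₀ = ∅`,
`F₀ ∈ {A, A'}` (theorems below); every cell with `n ≤ 5`.  Not pointwise-certifiable (LP value 91/522 over the full joint lattice).  OPEN. [this work] -/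
@[conjecture] def HalfChainMidIneq : Prop :=
  ∀ (γ : Type) [DecidableEq γ] [Fintype γ] (P F₀ A A' F₁ G₀ B B' G₁ : Finset (Finset γ)),
    IsUpperSet (P : Set (Finset γ)) →
    IsUpperSet (F₀ : Set (Finset γ)) → IsUpperSet (A : Set (Finset γ)) → IsUpperSet (A' : Set (Finset γ)) → IsUpperSet (F₁ : Set (Finset γ)) →
    IsUpperSet (G₀ : Set (Finset γ)) → IsUpperSet (B : Set (Finset γ)) → IsUpperSet (B' : Set (Finset γ)) → IsUpperSet (G₁ : Set (Finset γ)) →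
    F₀ ⊆ A → F₀ ⊆ A' → A ⊆ F₁ → A' ⊆ F₁ → G₀ ⊆ B → B ⊆ B' → B' ⊆ G₁ →
    0 ≤ triWOne (complEquiv γ) P ∅ F₀ G₁ G₀ + triWOne (complEquiv γ) P ∅ F₁ G₀ G₁
        + triWOne (complEquiv γ) P ∅ A B' B + triWOne (complEquiv γ) P ∅ A' B B'

/-- **(HC) ⟹ the half-chain stratum of `TriWIneq` at `a = 2`**: `univ = {a, b}`, `G{a} ⊆ G{b}`, `F` arbitrary ⟹ `0 ≤ triW P F G`. [this work] -/
theorem triW_nonneg_two_of_halfChainMid (h : HalfChainMidIneq) {β : Type} [DecidableEq β] [Fintype β] {a b : β} (hab : a ≠ b)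
    (hu : (univ : Finset β) = {a, b}) (P : Finset (Finset γ)) (F G : Finset β → Finset (Finset γ))
    (hP : IsUpperSet (P : Set (Finset γ))) (hF : ∀ x, IsUpperSet (F x : Set (Finset γ))) (hG : ∀ x, IsUpperSet (G x : Set (Finset γ)))
    (hFm : Monotone F) (hGm : Monotone G) (hGab : G {a} ⊆ G {b}) :
    0 ≤ triW P F G := by
  rw [triW_two_eq_fourMid hab hu P F G]
  exact h γ P (F ∅) (F {a}) (F {b}) (F univ) (G ∅) (G {a}) (G {b}) (G univ) hP (hF ∅) (hF {a}) (hF {b}) (hF univ) (hG ∅) (hG {a}) (hG {b}) (hG univ)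
    (hFm (empty_subset _)) (hFm (empty_subset _)) (hFm (subset_univ _)) (hFm (subset_univ _)) (hGm (empty_subset _)) hGab (hGm (subset_univ _))

/-- The mirror orientation `G{b} ⊆ G{a}` (swap the roles of the two atoms). [this work] -/
theorem triW_nonneg_two_of_halfChainMid' (h : HalfChainMidIneq) {β : Type} [DecidableEq β] [Fintype β] {a b : β} (hab : a ≠ b)
    (hu : (univ : Finset β) = {a, b}) (P : Finset (Finset γ)) (F G : Finset β → Finset (Finset γ))
    (hP : IsUpperSet (P : Set (Finset γ))) (hF : ∀ x, IsUpperSet (F x : Set (Finset γ))) (hG : ∀ x, IsUpperSet (G x : Set (Finset γ)))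
    (hFm : Monotone F) (hGm : Monotone G) (hGba : G {b} ⊆ G {a}) :
    0 ≤ triW P F G := by
  have hu' : (univ : Finset β) = {b, a} := by rw [hu, pair_comm]
  exact triW_nonneg_two_of_halfChainMid h hab.symm hu' P F G hP hF hG hFm hGm hGba

/-! ### The diamond family: transporting family-level strata to the 9-set language -/

/-- The monotone family on the index square `univ = {a,b}` with prescribed fibres `F₀, A, A', F₁` at `∅, {a}, {b}, univ`. [this work] -/
def dfam {β : Type} [DecidableEq β] (a b : β) (F₀ A A' F₁ : Finset (Finset γ)) : Finset β → Finset (Finset γ) :=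
  fun x => if a ∈ x then (if b ∈ x then F₁ else A) else (if b ∈ x then A' else F₀)

section dfam

variable {β : Type} [DecidableEq β] [Fintype β] {a b : β}

omit [DecidableEq γ] [Fintype γ] [Fintype β] in
/-- Bottom fibre of the diamond family. [this work] -/
theorem dfam_empty (F₀ A A' F₁ : Finset (Finset γ)) : dfam a b F₀ A A' F₁ ∅ = F₀ := by
  simp [dfam]

omit [DecidableEq γ] [Fintype γ] [Fintype β] in
/-- Left middle fibre of the diamond family. [this work] -/
theorem dfam_left (hab : a ≠ b) (F₀ A A' F₁ : Finset (Finset γ)) : dfam a b F₀ A A' F₁ {a} = A := by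
  have : b ∉ ({a} : Finset β) := fun h => hab.symm (mem_singleton.1 h)
  simp [dfam, this]

omit [DecidableEq γ] [Fintype γ] [Fintype β] in
/-- Right middle fibre of the diamond family. [this work] -/
theorem dfam_right (hab : a ≠ b) (F₀ A A' F₁ : Finset (Finset γ)) : dfam a b F₀ A A' F₁ {b} = A' := by
  have : a ∉ ({b} : Finset β) := fun h => hab (mem_singleton.1 h)
  simp [dfam, this]

omit [DecidableEq γ] [Fintype γ] in
/-- Top fibre of the diamond family. [this work] -/
theorem dfam_univ (F₀ A A' F₁ : Finset (Finset γ)) : dfam a b F₀ A A' F₁ (univ : Finset β) = F₁ := by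
  simp [dfam]

omit [DecidableEq γ] [Fintype γ] [Fintype β] in
/-- The diamond family is monotone when `F₀ ⊆ A, A' ⊆ F₁`. [this work] -/
theorem dfam_monotone {F₀ A A' F₁ : Finset (Finset γ)} (h₁ : F₀ ⊆ A) (h₂ : F₀ ⊆ A') (h₃ : A ⊆ F₁) (h₄ : A' ⊆ F₁) :
    Monotone (dfam a b F₀ A A' F₁ : Finset β → Finset (Finset γ)) := by
  intro x y hxy
  by_cases hay : a ∈ y <;> by_cases hby : b ∈ y
  · -- top fibre
    have htop : ∀ z : Finset β, dfam a b F₀ A A' F₁ z ⊆ F₁ := by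
      intro z; unfold dfam
      by_cases haz : a ∈ z <;> by_cases hbz : b ∈ z <;> simp only [haz, hbz, if_true, if_false]
      · exact subset_rfl
      · exact h₃
      · exact h₄
      · exact h₁.trans h₃
    have hy : dfam a b F₀ A A' F₁ y = F₁ := by unfold dfam; simp only [hay, hby, if_true]
    rw [hy]; exact htop x
  · have hbx : b ∉ x := fun h => hby (hxy h)
    have hy : dfam a b F₀ A A' F₁ y = A := by unfold dfam; simp only [hay, hby, if_true, if_false]
    rw [hy]; unfold dfam
    by_cases hax : a ∈ x <;> simp only [hax, hbx, if_true, if_false]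
    · exact subset_rfl
    · exact h₁
  · have hax : a ∉ x := fun h => hay (hxy h)
    have hy : dfam a b F₀ A A' F₁ y = A' := by unfold dfam; simp only [hay, hby, if_true, if_false]
    rw [hy]; unfold dfam
    by_cases hbx : b ∈ x <;> simp only [hax, hbx, if_true, if_false]
    · exact subset_rfl
    · exact h₂
  · have hax : a ∉ x := fun h => hay (hxy h)
    have hbx : b ∉ x := fun h => hby (hxy h)
    unfold dfam; simp only [hax, hbx, hay, hby, if_false]; exact subset_rfl

omit [DecidableEq γ] [Fintype γ] [Fintype β] in
/-- Every fibre of the diamond family is an up-set when the four prescribed fibres are. [this work] -/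
theorem dfam_upper {F₀ A A' F₁ : Finset (Finset γ)} (hF₀ : IsUpperSet (F₀ : Set (Finset γ))) (hA : IsUpperSet (A : Set (Finset γ)))
    (hA' : IsUpperSet (A' : Set (Finset γ))) (hF₁ : IsUpperSet (F₁ : Set (Finset γ))) :
    ∀ x : Finset β, IsUpperSet ((dfam a b F₀ A A' F₁ x : Finset (Finset γ)) : Set (Finset γ)) := by
  intro x
  unfold dfam
  by_cases hax : a ∈ x <;> by_cases hbx : b ∈ x <;> simp only [hax, hbx, if_true, if_false]
  · exact hF₁
  · exact hA
  · exact hA'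
  · exact hF₀

/-- `triW` of two diamond families is the four-middle sum of `HalfChainMidIneq` / `triW_two_eq_fourMid`. [this work] -/
theorem triW_dfam (hab : a ≠ b) (hu : (univ : Finset β) = {a, b}) (P F₀ A A' F₁ G₀ B B' G₁ : Finset (Finset γ)) :
    triW P (dfam a b F₀ A A' F₁) (dfam a b G₀ B B' G₁)
      = triWOne (complEquiv γ) P ∅ F₀ G₁ G₀ + triWOne (complEquiv γ) P ∅ F₁ G₀ G₁
        + triWOne (complEquiv γ) P ∅ A B' B + triWOne (complEquiv γ) P ∅ A' B B' := by
  rw [triW_two_eq_fourMid hab hu, dfam_empty, dfam_empty, dfam_univ, dfam_univ, dfam_left hab, dfam_left hab, dfam_right hab, dfam_right hab]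

end dfam

/-! ### Proved cases of (HC), in the 9-set language -/

/-- The two-atom index cube `Finset Bool`: `univ = {true, false}`. [this work] -/
theorem univ_bool : (univ : Finset Bool) = {true, false} := by decide

/-- (HC) holds when the two middle `F`-fibres are COMPARABLE (`A ⊆ A'`: two nested five-up-set instances; `A' ⊆ A`: the anti-nested theorem AN♯3),
via `triW_nonneg_of_comparable_middles` on the diamond families over the index square `Finset Bool`. [this work] -/
theorem halfChainMid_of_comparable (P F₀ A A' F₁ G₀ B B' G₁ : Finset (Finset γ)) (hP : IsUpperSet (P : Set (Finset γ)))
    (hF₀ : IsUpperSet (F₀ : Set (Finset γ))) (hA : IsUpperSet (A : Set (Finset γ))) (hA' : IsUpperSet (A' : Set (Finset γ)))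
    (hF₁ : IsUpperSet (F₁ : Set (Finset γ))) (hG₀ : IsUpperSet (G₀ : Set (Finset γ))) (hB : IsUpperSet (B : Set (Finset γ)))
    (hB' : IsUpperSet (B' : Set (Finset γ))) (hG₁ : IsUpperSet (G₁ : Set (Finset γ)))
    (h₁ : F₀ ⊆ A) (h₂ : F₀ ⊆ A') (h₃ : A ⊆ F₁) (h₄ : A' ⊆ F₁) (hG₀B : G₀ ⊆ B) (hBB' : B ⊆ B') (hB'G₁ : B' ⊆ G₁)
    (hcomp : A ⊆ A' ∨ A' ⊆ A) :
    0 ≤ triWOne (complEquiv γ) P ∅ F₀ G₁ G₀ + triWOne (complEquiv γ) P ∅ F₁ G₀ G₁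
        + triWOne (complEquiv γ) P ∅ A B' B + triWOne (complEquiv γ) P ∅ A' B B' := by
  have htf : (true : Bool) ≠ false := by decide
  rw [← triW_dfam htf univ_bool P F₀ A A' F₁ G₀ B B' G₁]
  refine triW_nonneg_of_comparable_middles htf univ_bool P _ _ hP (dfam_upper hF₀ hA hA' hF₁) (dfam_upper hG₀ hB hB' hG₁)
    (dfam_monotone h₁ h₂ h₃ h₄) (dfam_monotone hG₀B (hG₀B.trans hBB') (hBB'.trans hB'G₁) hB'G₁) ?_ ?_
  · rw [dfam_left htf, dfam_right htf]; exact hcomp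
  · rw [dfam_left htf, dfam_right htf]; exact Or.inl hBB'

/-- (HC) holds when the bottom `F`-fibre is EMPTY (`F₀ = ∅`; the middles arbitrary): prim-lf-1 gen 37's `triW_nonneg_of_bot_empty_of_halfChain`
transported through the diamond families. [this work] -/
theorem halfChainMid_of_bot_empty (P A A' F₁ G₀ B B' G₁ : Finset (Finset γ)) (hP : IsUpperSet (P : Set (Finset γ)))
    (hA : IsUpperSet (A : Set (Finset γ))) (hA' : IsUpperSet (A' : Set (Finset γ)))
    (hF₁ : IsUpperSet (F₁ : Set (Finset γ))) (hG₀ : IsUpperSet (G₀ : Set (Finset γ))) (hB : IsUpperSet (B : Set (Finset γ)))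
    (hB' : IsUpperSet (B' : Set (Finset γ))) (hG₁ : IsUpperSet (G₁ : Set (Finset γ)))
    (h₃ : A ⊆ F₁) (h₄ : A' ⊆ F₁) (hG₀B : G₀ ⊆ B) (hBB' : B ⊆ B') (hB'G₁ : B' ⊆ G₁) :
    0 ≤ triWOne (complEquiv γ) P ∅ ∅ G₁ G₀ + triWOne (complEquiv γ) P ∅ F₁ G₀ G₁
        + triWOne (complEquiv γ) P ∅ A B' B + triWOne (complEquiv γ) P ∅ A' B B' := by
  have htf : (true : Bool) ≠ false := by decide
  rw [← triW_dfam htf univ_bool P ∅ A A' F₁ G₀ B B' G₁]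
  refine triW_nonneg_of_bot_empty_of_halfChain htf univ_bool P _ _ hP (dfam_upper isUpperSet_empty hA hA' hF₁) (dfam_upper hG₀ hB hB' hG₁)
    (dfam_monotone (empty_subset _) (empty_subset _) h₃ h₄) (dfam_monotone hG₀B (hG₀B.trans hBB') (hBB'.trans hB'G₁) hB'G₁) ?_ ?_
  · exact dfam_empty _ _ _ _
  · rw [dfam_left htf, dfam_right htf]; exact hBB'

/-- (HC) holds when a middle `F`-fibre equals the bottom one (`A = F₀` or `A' = F₀`): prim-lf-1 gen 27's `triW_nonneg_of_bot_eq_atom` (rank certificate Σ)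
transported through the diamond families. [this work] -/
theorem halfChainMid_of_bot_eq (P F₀ A A' F₁ G₀ B B' G₁ : Finset (Finset γ)) (hP : IsUpperSet (P : Set (Finset γ)))
    (hF₀ : IsUpperSet (F₀ : Set (Finset γ))) (hA : IsUpperSet (A : Set (Finset γ))) (hA' : IsUpperSet (A' : Set (Finset γ)))
    (hF₁ : IsUpperSet (F₁ : Set (Finset γ))) (hG₀ : IsUpperSet (G₀ : Set (Finset γ))) (hB : IsUpperSet (B : Set (Finset γ)))
    (hB' : IsUpperSet (B' : Set (Finset γ))) (hG₁ : IsUpperSet (G₁ : Set (Finset γ)))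
    (h₁ : F₀ ⊆ A) (h₂ : F₀ ⊆ A') (h₃ : A ⊆ F₁) (h₄ : A' ⊆ F₁) (hG₀B : G₀ ⊆ B) (hBB' : B ⊆ B') (hB'G₁ : B' ⊆ G₁)
    (hbot : A = F₀ ∨ A' = F₀) :
    0 ≤ triWOne (complEquiv γ) P ∅ F₀ G₁ G₀ + triWOne (complEquiv γ) P ∅ F₁ G₀ G₁
        + triWOne (complEquiv γ) P ∅ A B' B + triWOne (complEquiv γ) P ∅ A' B B' := by
  have htf : (true : Bool) ≠ false := by decide
  rw [← triW_dfam htf univ_bool P F₀ A A' F₁ G₀ B B' G₁]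
  rcases hbot with hA0 | hA0'
  · refine triW_nonneg_of_bot_eq_atom htf univ_bool P _ _ hP (dfam_upper hF₀ hA hA' hF₁) (dfam_upper hG₀ hB hB' hG₁)
      (dfam_monotone h₁ h₂ h₃ h₄) (dfam_monotone hG₀B (hG₀B.trans hBB') (hBB'.trans hB'G₁) hB'G₁) true (Or.inl ?_)
    rw [dfam_empty, dfam_left htf, hA0]
  · refine triW_nonneg_of_bot_eq_atom htf univ_bool P _ _ hP (dfam_upper hF₀ hA hA' hF₁) (dfam_upper hG₀ hB hB' hG₁)
      (dfam_monotone h₁ h₂ h₃ h₄) (dfam_monotone hG₀B (hG₀B.trans hBB') (hBB'.trans hB'G₁) hB'G₁) false (Or.inl ?_)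
    rw [dfam_empty, dfam_right htf, hA0']

end FiveUpSet

end Summit.CriticalPhenomena.PercolationContinuityZ3.Theorems
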